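import Literature.Probability.Percolation.TriClaim10
import Literature.Probability.Percolation.ChayesLeiHexProofs
import HarnessLib

/-!
# Route CardyBondTriangular · crux `BondTriangularCardy` · line `birth`: kite darts of the Chayes–Lei interface (blue-arm frame)

Helper of the stub `stub_blueArm` (the blue arm of Bollobás–Riordan's Claim 10, *Percolation*
(2006), Ch. 7, pp. 177–179, for the Chayes–Lei hexagon model, Rev. Math. Phys. 19 (2007) §2.1).
The interface of Bollobás–Riordan is followed at the level of the **kite tiling**: the hexagon of
a site `x` is cut into six kites, one at each of its corners (faces of `𝕋` at `x`), the kite of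
`x` at the corner `F` being yellow iff `(σ x).yellowAt x F` for a hexagon of the 3-marked
domain `G`, and, for an outer hexagon, yellow iff it lies beyond a boundary dart of the stretches
`A₁, A₂` (blue beyond `A₀`; per dart, as in the tree's `Separates`, read through
`TriMarkedDomain.bdryCol₃`). This file sets up the darts of the kite tiling — half hexagon-edges
(`toMid`/`fromMid`, at a corner `F`, along the edge dual to the `j`-th side of `F`) and halves of
split lines (`toCtr`/`fromCtr`, between the centre of a hexagon and the midpoint of one of its
edges) —, their left and right kites, the interface condition (blue on the left, yellow on the
right) and the **successor** of an interface dart (the outgoing interface dart at its head,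
chosen by the colours there). Sub-namespace `KiteB` (distinct from the 4-mark toolkit `Kite` of
the duality stub).

## References

* B. Bollobás, O. Riordan, *Percolation*, CUP (2006), Ch. 7, Claim 10 pp. 177–179, Lemma 5 p. 170.
* L. Chayes, H. K. Lei, Rev. Math. Phys. 19 (2007), §2.1 (kites = half-edges of split hexagons).
-/

namespace Summit.CriticalPhenomena.CardyFormulaZ2.Theorems.BondTriangularCardyLine.KiteB

open Literature.Probability.Percolation Literature.Probability.LatticeModels
open RemovableAt (hexFaceVertices_leftFaceDir leftFaceDir_injective)

/-! ### The six corners of a hexagon, by direction, and the colour table of a state -/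

/-- **The corners of a hexagon by direction** (registered anchor of this file): the corner of `x`
to the left of the dart `x → x + triDir k` is `upCorner x 0, downCorner x 2, upCorner x 1,
downCorner x 0, upCorner x 2, downCorner x 1` for `k = 0, …, 5`. -/
theorem leftFaceDir_eq_corner : ∀ (x : Literature.Probability.LatticeModels.Site 2) (k : Fin 6), Literature.Probability.Percolation.leftFaceDir x k = (![Literature.Probability.Percolation.upCorner x 0, Literature.Probability.Percolation.downCorner x 2, Literature.Probability.Percolation.upCorner x 1, Literature.Probability.Percolation.downCorner x 0, Literature.Probability.Percolation.upCorner x 2, Literature.Probability.Percolation.downCorner x 1] : Fin 6 → Literature.Probability.LatticeModels.HexVertex) k := by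
  intro x k
  fin_cases k <;> simp [leftFaceDir, upCorner, downCorner, triUnit] <;> abel_nf

/-- **The colour table of a state**: whether the kite of a hexagon in state `st` at its corner in
direction `k` (see `leftFaceDir_eq_corner`) is yellow. -/
def ytab : CLHexState → Fin 6 → Bool
  | .Y, _ => true
  | .B, _ => false
  | .split j, k => (![decide (0 = j), decide (2 ≠ j), decide (1 = j), decide (0 ≠ j), decide (2 = j), decide (1 ≠ j)] :
      Fin 6 → Bool) k

/-- The colour of the kite of `x` at the corner `leftFaceDir x k` is read from the table. -/
theorem yellowAt_leftFaceDir_iff (st : CLHexState) (x : Site 2) (k : Fin 6) :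
    st.yellowAt x (leftFaceDir x k) ↔ ytab st k = true := by
  rcases st with _ | _ | j
  · simp [ytab]
  · simp [ytab]
  · rw [leftFaceDir_eq_corner]
    fin_cases k <;> simp [ytab]


/-- In an admissible state a kite yellow at an up-corner (even direction) has yellow neighbouring
kites: the table read at `k`, `k + 1`, `k + 5`. (Chayes–Lei: only three of the six splits occur.) -/
theorem ytab_consecutive (st : CLHexState) (k : Fin 6) (hk : k = 0 ∨ k = 2 ∨ k = 4) (h : ytab st k = true) :
    ytab st (k + 1) = true ∧ ytab st (k + 5) = true := by
  rcases st with _ | _ | j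
  · simp [ytab]
  · simp [ytab] at h
  · revert h; rcases hk with rfl | rfl | rfl <;> fin_cases j <;> simp [ytab]

/-- Dually, a kite blue at a down-corner (odd direction) has blue neighbouring kites. -/
theorem ytab_consecutive' (st : CLHexState) (k : Fin 6) (hk : k = 1 ∨ k = 3 ∨ k = 5) (h : ytab st k = false) :
    ytab st (k + 1) = false ∧ ytab st (k + 5) = false := by
  rcases st with _ | _ | j
  · simp [ytab] at h
  · simp [ytab]
  · revert h; rcases hk with rfl | rfl | rfl <;> fin_cases j <;> simp [ytab]

/-- **Opposite kites of a two-coloured hexagon have opposite colours, and each colour class is a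
half-hexagon**: if the kites in directions `k + 5` (blue) and `k` (yellow) differ, then the kites
in directions `k + 3, k + 4` are blue and those in directions `k + 1, k + 2` yellow (the split
line runs from the midpoint of the edge `k / k+5` to the opposite midpoint). -/
theorem ytab_halves (st : CLHexState) (k : Fin 6) (h5 : ytab st (k + 5) = false) (h0 : ytab st k = true) :
    ytab st (k + 3) = false ∧ ytab st (k + 4) = false ∧ ytab st (k + 1) = true ∧ ytab st (k + 2) = true := by
  rcases st with _ | _ | j
  · simp [ytab] at h5
  · simp [ytab] at h0
  · revert h5 h0; fin_cases k <;> fin_cases j <;> simp [ytab]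

/-! ### Kite colours in a 3-marked domain: hexagons of `G` by their state, outer hexagons by darts -/

section Colour

variable (D : TriMarkedDomain 3) (σ : CLHexConfig)

open Classical in
/-- **The colour of the kite of the `j`-th cell of the face `F` at `F`** (`true` = yellow): for a
hexagon of `G` its Chayes–Lei colour at the corner `F`; for an outer hexagon the colour of the
outer arc beyond the boundary dart into it from the next vertex of `F` if that one is in `G`, else
from the one after (`bdryCol₃`: blue beyond `A₀`, yellow beyond `A₁, A₂`) — verbatim the tree's
`vcol₃` with the site colour replaced by the kite colour. -/
noncomputable def kcol (F : HexVertex) (j : Fin 3) : Bool :=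
  if faceVertex F j ∈ D.verts then decide ((σ (faceVertex F j)).yellowAt (faceVertex F j) F)
  else if faceVertex F (j + 1) ∈ D.verts then D.bdryCol₃ (D.dpos (faceVertex F (j + 1), faceVertex F j))
  else D.bdryCol₃ (D.dpos (faceVertex F (j + 2), faceVertex F j))

open Classical in
/-- The index of the cell `x` in the face `F` (junk `2` if `x` is not a vertex of `F`). -/
noncomputable def kidx (F : HexVertex) (x : Site 2) : Fin 3 :=
  if faceVertex F 0 = x then 0 else if faceVertex F 1 = x then 1 else 2

/-- **The colour of the kite of the cell `x` at its corner `F`.** -/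
noncomputable def ccol (x : Site 2) (F : HexVertex) : Bool := kcol D σ F (kidx F x)

variable {D σ}

/-- The index of a labelled vertex. -/
@[simp] theorem kidx_faceVertex (F : HexVertex) (j : Fin 3) : kidx F (faceVertex F j) = j := by
  unfold kidx
  have hinj := faceVertex_injective F
  have h10 : faceVertex F 0 ≠ faceVertex F 1 := fun h => absurd (hinj h) (by decide)
  have h20 : faceVertex F 0 ≠ faceVertex F 2 := fun h => absurd (hinj h) (by decide)
  have h21 : faceVertex F 1 ≠ faceVertex F 2 := fun h => absurd (hinj h) (by decide)
  fin_cases j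
  · exact if_pos rfl
  · exact (if_neg h10).trans (if_pos rfl)
  · exact (if_neg h20).trans (if_neg h21)

/-- A vertex of a face is the labelled vertex of its index. -/
theorem faceVertex_kidx {F : HexVertex} {x : Site 2} (hx : x ∈ hexFaceVertices F) : faceVertex F (kidx F x) = x := by
  obtain ⟨j, rfl⟩ := mem_hexFaceVertices_iff_faceVertex.1 hx
  rw [kidx_faceVertex]

/-- The kite colour of a labelled vertex. -/
@[simp] theorem ccol_faceVertex (F : HexVertex) (j : Fin 3) : ccol D σ (faceVertex F j) F = kcol D σ F j := by
  rw [ccol, kidx_faceVertex]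

/-- **The kite colour of a hexagon of `G` is its Chayes–Lei colour at that corner.** -/
theorem ccol_of_mem {x : Site 2} {F : HexVertex} (hx : x ∈ D.verts) (hF : x ∈ hexFaceVertices F) :
    ccol D σ x F = decide ((σ x).yellowAt x F) := by
  obtain ⟨j, rfl⟩ := mem_hexFaceVertices_iff_faceVertex.1 hF
  rw [ccol_faceVertex, kcol, if_pos hx]

/-- The kite colour of a hexagon of `G` at its corner in direction `k`, from the table. -/
theorem ccol_leftFaceDir {x : Site 2} (hx : x ∈ D.verts) (k : Fin 6) :
    ccol D σ x (leftFaceDir x k) = ytab (σ x) k := by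
  rw [ccol_of_mem hx (by rw [hexFaceVertices_leftFaceDir]; simp)]
  by_cases h : ytab (σ x) k = true
  · rw [h, decide_eq_true_iff, yellowAt_leftFaceDir_iff]; exact h
  · have h' : ytab (σ x) k = false := by simpa using h
    rw [h', decide_eq_false_iff_not, yellowAt_leftFaceDir_iff]; exact h

/-- **The kite colour of an outer hexagon is the colour beyond the boundary dart into it** from
any hexagon of `G` in the same face (the two possible views agree, `bdryCol_views_eq₃`). -/
theorem ccol_of_not_mem {o y : Site 2} {F : HexVertex} (ho : o ∉ D.verts) (hy : y ∈ D.verts)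
    (hoF : o ∈ hexFaceVertices F) (hyF : y ∈ hexFaceVertices F) :
    ccol D σ o F = D.bdryCol₃ (D.dpos (y, o)) := by
  obtain ⟨j, rfl⟩ := mem_hexFaceVertices_iff_faceVertex.1 hoF
  obtain ⟨i, rfl⟩ := mem_hexFaceVertices_iff_faceVertex.1 hyF
  rw [ccol_faceVertex, kcol, if_neg ho]
  have hi : i = j + 1 ∨ i = j + 2 := by
    have hij : i ≠ j := by rintro rfl; exact ho hy
    have : i = j ∨ i = j + 1 ∨ i = j + 2 := by
      rcases (show ∃ d, i = j + d from ⟨i - j, by abel⟩) with ⟨d, rfl⟩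
      fin_cases d
      · exact Or.inl (by simp)
      · exact Or.inr (Or.inl rfl)
      · exact Or.inr (Or.inr rfl)
    rcases this with h | h
    · exact absurd h hij
    · exact h
  rcases hi with rfl | rfl
  · rw [if_pos hy]
  · by_cases h1 : faceVertex F (j + 1) ∈ D.verts
    · rw [if_pos h1]; exact (D.bdryCol_views_eq₃ ho h1 hy).symm
    · rw [if_neg h1]

end Colour

/-! ### Kite darts -/

/-- **A dart of the kite tiling**: `toMid F j` runs from the corner `F` along the hexagon edge dual
to the `j`-th side of `F` (between the hexagons of `faceVertex F (j+1)` and `faceVertex F (j+2)`)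
to its midpoint, `fromMid F j` back; `toCtr x y` runs from the midpoint of the edge between the
hexagons of the adjacent sites `x, y` to the centre of the hexagon of `x` (half of a split line),
`fromCtr x y` back. -/
inductive KDart : Type
  /-- from the corner `F` to the midpoint of the edge dual to its `j`-th side -/
  | toMid : HexVertex → Fin 3 → KDart
  /-- from the midpoint of the edge dual to the `j`-th side of `F` to the corner `F` -/
  | fromMid : HexVertex → Fin 3 → KDart
  /-- from the midpoint of the edge between `H_x` and `H_y` to the centre of `H_x` -/
  | toCtr : Site 2 → Site 2 → KDart
  /-- from the centre of `H_x` to the midpoint of the edge between `H_x` and `H_y` -/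
  | fromCtr : Site 2 → Site 2 → KDart
  deriving DecidableEq

namespace KDart

/-- Admissible darts: the two sites of a split-line dart are adjacent. -/
def adm : KDart → Bool
  | toMid _ _ => true
  | fromMid _ _ => true
  | toCtr x y => decide (triGraph.Adj x y)
  | fromCtr x y => decide (triGraph.Adj x y)

/-- The hexagon of the kite on the left of the dart. -/
def leftCell : KDart → Site 2
  | toMid F j => faceVertex F (j + 2)
  | fromMid F j => faceVertex F (j + 1)
  | toCtr x _ => x
  | fromCtr x _ => x

/-- The hexagon of the kite on the right of the dart. -/
def rightCell : KDart → Site 2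
  | toMid F j => faceVertex F (j + 1)
  | fromMid F j => faceVertex F (j + 2)
  | toCtr x _ => x
  | fromCtr x _ => x

/-- The corner at which the left kite sits. -/
noncomputable def leftCorner : KDart → HexVertex
  | toMid F _ => F
  | fromMid F _ => F
  | toCtr x y => leftFace y x
  | fromCtr x y => leftFace x y

/-- The corner at which the right kite sits. -/
noncomputable def rightCorner : KDart → HexVertex
  | toMid F _ => F
  | fromMid F _ => F
  | toCtr x y => leftFace x y
  | fromCtr x y => leftFace y x

/-- The reversed dart. -/
def rev : KDart → KDart
  | toMid F j => fromMid F j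
  | fromMid F j => toMid F j
  | toCtr x y => fromCtr x y
  | fromCtr x y => toCtr x y

/-- Reversal is an involution. -/
@[simp] theorem rev_rev (d : KDart) : d.rev.rev = d := by cases d <;> rfl

/-- Reversal swaps the left and right cells. -/
@[simp] theorem leftCell_rev (d : KDart) : d.rev.leftCell = d.rightCell := by cases d <;> rfl

/-- Reversal swaps the right and left cells. -/
@[simp] theorem rightCell_rev (d : KDart) : d.rev.rightCell = d.leftCell := by cases d <;> rfl

/-- Reversal swaps the corners of the side kites. -/
@[simp] theorem leftCorner_rev (d : KDart) : d.rev.leftCorner = d.rightCorner := by cases d <;> rfl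

/-- Reversal swaps the corners of the side kites. -/
@[simp] theorem rightCorner_rev (d : KDart) : d.rev.rightCorner = d.leftCorner := by cases d <;> rfl

/-- Reversal preserves admissibility. -/
@[simp] theorem adm_rev (d : KDart) : d.rev.adm = d.adm := by cases d <;> rfl

/-- Admissibility of a dart into a centre. -/
@[simp] theorem adm_toCtr (x y : Site 2) : (toCtr x y).adm = true ↔ triGraph.Adj x y := by simp [adm]

/-- Admissibility of a dart out of a centre. -/
@[simp] theorem adm_fromCtr (x y : Site 2) : (fromCtr x y).adm = true ↔ triGraph.Adj x y := by simp [adm]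

/-- Half-edges are admissible. -/
@[simp] theorem adm_toMid (F : HexVertex) (j : Fin 3) : (toMid F j).adm = true := rfl

/-- Half-edges are admissible. -/
@[simp] theorem adm_fromMid (F : HexVertex) (j : Fin 3) : (fromMid F j).adm = true := rfl

end KDart

/-! ### The interface condition and the successor -/

section Machine

variable (D : TriMarkedDomain 3) (κ : HexVertex → Fin 3 → Bool)

/-- The colour of the kite of `x` at `F`, for an abstract kite colouring by face and index. -/
noncomputable def kc (x : Site 2) (F : HexVertex) : Bool := κ F (kidx F x)

/-- The colour of the left kite of a dart. -/
noncomputable def lcol (d : KDart) : Bool := kc κ d.leftCell d.leftCorner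

/-- The colour of the right kite of a dart. -/
noncomputable def rcol (d : KDart) : Bool := kc κ d.rightCell d.rightCorner

/-- **Interface dart**: blue kite on the left, yellow kite on the right (an edge of the interface
graph `I` of Bollobás–Riordan, p. 170/178, oriented, at the level of kites). -/
noncomputable def iface (d : KDart) : Bool := !lcol κ d && rcol κ d

/-- The interface condition, unfolded. -/
theorem iface_iff (d : KDart) : iface κ d = true ↔ lcol κ d = false ∧ rcol κ d = true := by
  simp [iface]

/-- **The successor of a dart along the interface**: the outgoing interface dart at its head.
At a corner the third kite decides between the two other edges; at the midpoint of an edge the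
walk turns into the left hexagon along its split line if its kite ahead is yellow, else goes on
to the far corner if the right hexagon's kite ahead is yellow, else turns into the right hexagon;
at a centre it continues along the split line to the opposite edge; arriving at a midpoint along
a split line it turns towards the corner on its left if the hexagon across is yellow there, else
continues into that hexagon if it is yellow at the corner on the right, else turns right. -/
noncomputable def succ : KDart → KDart
  | .fromMid F j => if κ F j then .toMid F (j + 2) else .toMid F (j + 1)
  | .toMid F j =>
      if κ (oppFace F j) (oppIdx F j + 1) then .toCtr (faceVertex F (j + 2)) (faceVertex F (j + 1))
      else if κ (oppFace F j) (oppIdx F j + 2) then .fromMid (oppFace F j) (oppIdx F j)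
      else .toCtr (faceVertex F (j + 1)) (faceVertex F (j + 2))
  | .toCtr x y => .fromCtr x (x + (x - y))
  | .fromCtr x y =>
      if kc κ y (leftFace x y) then .fromMid (leftFace x y) (kidx (leftFace x y) x + 2)
      else if kc κ y (leftFace y x) then .toCtr y x
      else .fromMid (leftFace y x) (kidx (leftFace y x) y + 2)

end Machine

end Summit.CriticalPhenomena.CardyFormulaZ2.Theorems.BondTriangularCardyLine.KiteB
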